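import Summits.QuantumFields.YangMills.Theorems.BalabanUVNodesN11SupplyChainFirstStepSupplier
import Summits.QuantumFields.YangMills.Theorems.BalabanUVNodesN11Sect3SupplyChainBorelBThm1PrintedOfScalars

/-!
# DAG node N11 — BOREL 𝐁-TERMS ALONG THE WITNESS CHAIN, VIII: `SupplierBorel` AT dag-n08-w2's FIRST-STEP SUPPLIER — the BorelB road's first producer beyond the zero
# supplier — and, in the run whose expansion children above the first level are 𝐓-absent, N11's token `SupplyChainAt θ p` ∕ THEOREM 1 of [III] (all levels) ∕ the p. 245
# laws at a Gaussian certificate from FIRST-STEP DATA + JOINT BOREL-NESS OF `u`'s BOUNDARY TERMS + K0's rows — NO term row, NO 𝐄 ∕ 𝐑 ∕ 𝐁 bound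

HEADER — WORK-UNIT METADATA.  Cell `pub-ymgap`, YM-PLAN Track A (HUMAN RULING D-0062 ∕ D-0149 width seats), seat `pub-ymgap-dag-n11-w1` (g3; WIDTH SEAT 1 of 4 on NODE n11
[B14]; harness re-seat of g2), route `BalabanUVNodes` rev 25 (v1.7 `CoPH` key), item K1⁷ `StabilityBAtRecordR13SepCoPH` = stmt-QuantumFields-20542 (helper lane, `--kind proof
--supports 20542 --as helper`, count-neutral).  Item (o1) of this seat's g2 ASK-NEXT (pub-ymgap INBOX 2026-08-28T06:38Z; dag-n11-e g20 06:56Z: «no objection»; self-located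
CLAIM-1 of g3, 08:12Z).  [III] = [Balaban1988Convergent], [I] = [Balaban1987RG1], [IV] = [Balaban1989LargeFieldI], [15] = [Balaban1985Variational].  Over dag-n08-w2's
`…N11SupplyChainFirstLink` ∕ `…N11SupplyChainFirstStepSupplier` (p597418 ∕ p607400: `firstStepSupplier θ p u E₁` — the level-`0` response `(u, E₁)` and ZERO responses above —,
`FirstLinkObligations`, `supplierObligations_firstStepSupplier`, `supplierObligations_firstStepSupplier_iff_data`, `supplierObligations_firstStepSupplier_of_supplierObligations`),
this seat's `…N11Sect3SupplyChainBorelB` (p596175: `SupplierBorel`), `…BorelBObligationsOfSolvable` (p607459 §3), `…BorelBThm1PrintedOfSolvable` (p607924 §4) and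
`…BorelBThm1PrintedOfScalars` (p609410 §6), and dag-n11-e's `…Sect3SupplyChainDefs ∕ …ObligationsDefs` (`Sect3Supplier`, `chainWitness`, `chainWitness_zero`, `baseWitness`,
`SupplierObligations`, `NoExpansionObligation`, `SupplyChainAt`).

WHY THIS FILE.  The BorelB road (files I–VII of this seat) discharges the no-expansion half of N11's one-token residual `SupplyChainAt θ p` at any `θ` of the Gaussian-certificate
class from K0's rows, the run's structure and ONE law on the supplier's named terms: `SupplierBorel θ p σ` — the boundary terms `𝐁^{(j)}(X, ι U, (S′, A))` of the supplier's
responses along its own chain are jointly Borel in `(U, A)`.  So far the tree inhabits that predicate only at dag-n11-e's ZERO supplier (`supplierBorel_zeroSupplier`, p604363,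
`measurable_const`).  dag-n08-w2's first-step supplier `firstStepSupplier θ p u E₁` (p597418) is the supplier of the run in which the 𝐓-image charges expansion children AT THE
FIRST LEVEL ONLY («𝐓 absent above the first level»); its responses above level `0` are zero, so (§1) `SupplierBorel` for it IS joint Borel-ness of the level-`0` response
`u`'s boundary terms — the BorelB twin of p607400's `supplierTermRows_firstStepSupplier_iff` —, every supplier meeting `SupplierObligations ∧ SupplierBorel` is matched by the
first-step supplier of its own level-`0` response, and `(∃ σ, SupplierObligations ∧ SupplierBorel)` ⟺ «first-step data ∧ u-Borel»; (§2) composing with p607459 §3, in such a run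
N11's token, THEOREM 1 of [III] at all levels and the p. 245 laws hold at any Gaussian-class `θ` from first-step data ([I] Thm 1 + [II] at def-T's level-1 objects, as data),
u-Borel-ness, `2 ≤ cR`, the run's window and `PartCompat₁₃`, the five numeric rows, K0's per-cube [15]-solvability and the cube cover — NO term row of `u`, NO 𝐄 ∕ 𝐑 ∕ 𝐁 bound;
(§3) the same with the numeric rows and the cover folded to scalars (p609410 §6), and at the NAMED certificate `gaussPinH θ`.

THE TRADE (honest).  dag-n08-w2's §4∕§5 (p607400) reach the same token ∕ Theorem 1 in such a run by the CHEAPER Gaussian road of dag-n11-e (`…_of_gaussCert`: `u`'s TERM ROWS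
`TermRowsAt θ p (u s) j` ⇒ def-T's operand rows; no `cR`, no K0 row, no `PartCompat₁₃`); the present faces trade the term rows (bounds) for Borel-ness of `u`'s 𝐁-terms plus K0's
solvability rows and `2 ≤ cR` — the BorelB column of the door catalogue at this supplier, not a shorter road.  `2 ≤ cR` is UNINHABITED at every witness of record (`cR = 1`:
dag-n11-d LOCATED-cR, INBOX 2026-08-28T06:17Z; owner node00-def-K0a), so no record ∕ θ₁₅ᶜᶜᴹᵂ edition is offered.  All faces are PER RUN `p` (`hw` the run's window, `hPC :
PartCompat₁₃ … p p.K` for THAT run — the satisfiable shape, [III] p. 257); NO `B16.Thm1Printed` face is typed here: its `∀ P, window → PartCompat₁₃` binder is the one dag-n11-w4 g4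
(INBOX 2026-08-28T07:47Z) types as unsatisfiable at every `γ`.

WHAT THIS FILE PROVES (10 theorems, 0 `def`, 0 `sorry`; standard axioms).
§1 ★ `supplierBorel_firstStepSupplier_iff` · `supplierBorel_firstStepSupplier` · `supplierBorel_firstStepSupplier_response_iff` · `supplierBorel_firstStepSupplier_of_supplierBorel` ·
   ★ `exists_supplierObligations_borelB_iff_exists_firstStepDataBorelB`.
§2 (generic Gaussian-class `θ`, p607459 §3 at `σ := firstStepSupplier θ p u E₁`) ★★ `supplyChainAt_of_firstStepSupplier_of_gaussCert_of_borelB_of_solvable` ·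
   `sLaw₁₃CoPH_all_of_firstStepSupplier_of_gaussCert_of_borelB_of_solvable` · `thmP245Laws_of_firstStepSupplier_of_gaussCert_of_borelB_of_solvable`.
§3 (scalars, p609410 §6) `supplyChainAt_of_firstStepSupplier_of_gaussCert_of_borelB_of_nesting_of_scalars` · (named certificate) ★★
   `supplyChainAt_gaussPinH_of_firstStepSupplier_of_borelB_of_nesting_of_scalars`.

HONEST FRAMING.  Helper lane of K1⁷, count-neutral KERNEL BOOKKEEPING: one case split on the level and compositions BY NAME of landed theorems; first-step data, u-Borel-ness,
the key, K0's rows, `2 ≤ cR`, the window and `PartCompat₁₃` are DISPLAYED HYPOTHESES, inhabited at no `θ` here; the 𝐓-absent-above-the-first-level run is a DEGENERATE data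
regime (for the record's data every level's expansion children are charged — that is where [III] §3 is owed); nothing of Bałaban's analysis is asserted or proved.  N11 NOT
discharged; K1⁷ NOT closed, no registered stub touched; counts unmoved (typed 28∕28 · discharged 5∕27).  One finite `𝕋⁴_{L^K}` programme at fixed `ε = L^{−K}`; R4 closes only the
conditional finite-𝕋⁴ rung `BalabanLadder.UV` — NOT ℝ⁴, NOT OS, NOT a mass gap, NOT Clay.  No `sorry`, no `axiom`, no `def`, no `instance`, no `notation`.
Sources (SHAPE only): [III] Theorem p.245, Thm 1 p.262, Thm 2 p.263, §3 p.279, (3.1) p.264, (3.24)–(3.25) p.270, (2.27)–(2.28) p.259, (2.40)–(2.41) p.261, p.257; [I] Thm 1 p.258;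
[IV] (0.2)–(0.4) p.176, p.177 (i)–(ii); [15] Thm 1 (7)–(8) pp.278–279.
-/

noncomputable section

open MeasureTheory
open scoped BigOperators ENNReal NNReal Matrix.Norms.L2Operator

namespace Summit.QuantumFields.YangMills.Theorems.BalabanUVNodesN11SupplyChainFirstStepSupplierBorelB

open Literature.MathematicalPhysics.QuantumFieldTheory.Balaban1983to89 T4Continuum T4NestedCovariance Node00 Node00.Tk DagBinding
open B15DeterminingSets B8Eq17ClassAkV1 B14.Eq218Concrete B10Eq42TorusConstraint Step
open B14.Eq213MaximalDomains (side)
open B14.Eq213DetSet (Bj)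
open Literature.MathematicalPhysics.QuantumFieldTheory.BalabanImbrieJaffe1984to88.BIJ85Eq453GaugeField (qsstarGIter0)
open BalabanUVNodesN11HistoryPinnedResidualDefs BalabanUVNodesN11RePinnedParamDefs
open BalabanUVNodesN11FluctTruncationDefs (IsFluctLocal)
open BalabanUVNodesN11GaussianCertificateDefs (gaussPinH gaussPinH_ζ0 gaussPinH_quad provisos₁₃CoPH_gaussPinH)
open BalabanUVNodesN11Sect3SupplyChainDefs
open BalabanUVNodesN11Sect3SupplyChainBorelB
open BalabanUVNodesN11Sect3SupplyChainObligationsDefs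
open BalabanUVNodesN11Sect3SupplyChainBorelBObligationsOfSolvable
open BalabanUVNodesN11Sect3SupplyChainBorelBThm1PrintedOfSolvable
open BalabanUVNodesN11Sect3SupplyChainBorelBThm1PrintedOfScalars
open BalabanUVNodesN11SupplyChainFirstLink
open BalabanUVNodesN11SupplyChainFirstStepSupplier

variable {F : T4Family} {N : ℕ} [NeZero N]

/-! ## §1  `SupplierBorel` for the first-step supplier IS joint Borel-ness of the level-`0` response's boundary terms -/

section Borel

variable (θ : Stage13HParams F N) (p : B12.RunParams)
variable (u : SeqOfRecord F θ.ν θ.τ9.M (gOfRecord₁₃ F N θ.toStage13Params p) p.K 1 → Sect2.TermValues (F.P p.K) (MatA N) (FluctV N) θ.τ9.M)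
  (E₁ : SeqOfRecord F θ.ν θ.τ9.M (gOfRecord₁₃ F N θ.toStage13Params p) p.K 1 → ℝ)

/-- **★ `SupplierBorel` AT THE FIRST-STEP SUPPLIER ⟺ THE LEVEL-`0` RESPONSE's 𝐁 IS JOINTLY BOREL**: above level `0` the responses of `firstStepSupplier θ p u E₁` are ZERO term values,
whose boundary terms are the constant `0` (`measurable_const`); at level `0` the response is `u` itself.  The BorelB twin of dag-n08-w2's `supplierTermRows_firstStepSupplier_iff`.
NO absence hypothesis. [cite: Balaban1988Convergent, (2.40)–(2.41) p.261, (3.24)–(3.25) p.270, §3 p.279 (bookkeeping)] -/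
theorem supplierBorel_firstStepSupplier_iff :
    SupplierBorel θ p (firstStepSupplier θ p u E₁) ↔
      ∀ (s₀ : SeqOfRecord F θ.ν θ.τ9.M (gOfRecord₁₃ F N θ.toStage13Params p) p.K 1) (S' : ℕ → Set (Site (F.P p.K) 0)) (j : ℕ) (X : (Sect2.domSys (F.P p.K) θ.τ9.M j).Dom),
        Measurable (fun q : GaugeField (F.P p.K) 0 (SU N) × MSFluct (F.P p.K) (FluctV N) =>
          (u s₀).B j X (Sect2.ofBackgroundC (settingOfRecord₁₃ F N θ.toStage13Params p).ι q.1) (S', q.2)) := by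
  refine ⟨fun h s₀ S' j X => h 0 s₀ S' j X, fun h k s₀ S' j X => ?_⟩
  cases k with
  | zero => exact h s₀ S' j X
  | succ k => exact measurable_const  -- zero term values above level `0`: their `𝐁` is the constant `0`

/-- **`SupplierBorel` AT THE FIRST-STEP SUPPLIER FROM u-BOREL-NESS** (the producer direction of the previous `iff`). [cite: Balaban1988Convergent, (2.40)–(2.41) p.261, §3 p.279 (bookkeeping)] -/
theorem supplierBorel_firstStepSupplier
    (hu : ∀ (s₀ : SeqOfRecord F θ.ν θ.τ9.M (gOfRecord₁₃ F N θ.toStage13Params p) p.K 1) (S' : ℕ → Set (Site (F.P p.K) 0)) (j : ℕ) (X : (Sect2.domSys (F.P p.K) θ.τ9.M j).Dom),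
        Measurable (fun q : GaugeField (F.P p.K) 0 (SU N) × MSFluct (F.P p.K) (FluctV N) =>
          (u s₀).B j X (Sect2.ofBackgroundC (settingOfRecord₁₃ F N θ.toStage13Params p).ι q.1) (S', q.2))) :
    SupplierBorel θ p (firstStepSupplier θ p u E₁) :=
  (supplierBorel_firstStepSupplier_iff θ p u E₁).mpr hu

variable {θ p}

/-- **THE FIRST-STEP SUPPLIER OF `σ`'s OWN LEVEL-`0` RESPONSE IS BOREL ⟺ THE LEVEL-`0` SLICE OF `SupplierBorel θ p σ`** (both chains start at def-T's base witness,
`chainWitness_zero`, `rfl`). [cite: Balaban1988Convergent, §3 pp.264–265, (3.24)–(3.25) p.270 (bookkeeping)] -/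
theorem supplierBorel_firstStepSupplier_response_iff (σ : Sect3Supplier θ p) :
    SupplierBorel θ p (firstStepSupplier θ p (σ 0 (baseWitness θ p).1 (baseWitness θ p).2).1 (σ 0 (baseWitness θ p).1 (baseWitness θ p).2).2) ↔
      ∀ (s₀ : SeqOfRecord F θ.ν θ.τ9.M (gOfRecord₁₃ F N θ.toStage13Params p) p.K 1) (S' : ℕ → Set (Site (F.P p.K) 0)) (j : ℕ) (X : (Sect2.domSys (F.P p.K) θ.τ9.M j).Dom),
        Measurable (fun q : GaugeField (F.P p.K) 0 (SU N) × MSFluct (F.P p.K) (FluctV N) =>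
          ((σ 0 (chainWitness θ p σ 0).1 (chainWitness θ p σ 0).2).1 s₀).B j X (Sect2.ofBackgroundC (settingOfRecord₁₃ F N θ.toStage13Params p).ι q.1) (S', q.2)) :=
  supplierBorel_firstStepSupplier_iff θ p _ _

/-- **EVERY BOREL SUPPLIER IS MATCHED BY A BOREL FIRST-STEP SUPPLIER**: if `σ`'s boundary terms are jointly Borel along its chain, so are those of the first-step supplier of its own
level-`0` response (the level-`0` slice of the hypothesis; nothing above). [cite: Balaban1988Convergent, §3 p.279, (3.24)–(3.25) p.270 (bookkeeping)] -/
theorem supplierBorel_firstStepSupplier_of_supplierBorel {σ : Sect3Supplier θ p} (hσB : SupplierBorel θ p σ) :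
    SupplierBorel θ p (firstStepSupplier θ p (σ 0 (baseWitness θ p).1 (baseWitness θ p).2).1 (σ 0 (baseWitness θ p).1 (baseWitness θ p).2).2) :=
  (supplierBorel_firstStepSupplier_response_iff σ).mpr fun s₀ S' j X => hσB 0 s₀ S' j X

/-- **★ IN A RUN WITH NO 𝐓-PRESENT EXPANSION CHILD ABOVE THE FIRST LEVEL, THE BOREL SUPPLIER SIDE OF N11's TOKEN IS «FIRST-STEP DATA ∧ u-BOREL» — NOTHING ELSE** (`0 ≤ E₀`):
`(∃ σ, SupplierObligations θ p σ ∧ SupplierBorel θ p σ)` ⟺ SOME `u, E₁` with `u s` `1`-local at every `s`, (`0 < K` →) `u` universal in 𝐄, the four level-`1` 𝐄-clauses at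
every history, the first-step clauses at every 𝐓-present expansion pair ([I] Thm 1 + [II] at def-T's level-1 objects, as data — dag-n08-w2's ★★
`exists_supplierObligations_iff_exists_firstStepData`), AND `u`'s boundary terms jointly Borel.  Forward: the first-step supplier of `σ`'s own level-`0` response
(`supplierObligations_firstStepSupplier_of_supplierObligations` + the level-`0` slice of `SupplierBorel`); backward: §1.
[cite: Balaban1988Convergent, Thm 1 p.262, Thm 2 p.263, §3 p.279, (3.1) p.264, (3.25) p.270, (2.27)–(2.28) p.259, (2.40)–(2.41) p.261; Balaban1987RG1, Thm 1 p.258] -/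
theorem exists_supplierObligations_borelB_iff_exists_firstStepDataBorelB (hE₀ : 0 ≤ θ.s2.lf.E₀)
    (habs : ∀ k, 1 ≤ k → k < p.K → ∀ s : SeqOfRecord F θ.ν θ.τ9.M (gOfRecord₁₃ F N θ.toStage13Params p) p.K (k + 1), s.Ω (k + 1) ≠ ∅ →
      slotsTOfRecord F N θ.ν θ.τ9 (EOfRecord₁₃ F N θ.toStage13Params) (wOfRecord₉ F N θ.toStage9Params) θ.ppSel p (gOfRecord₁₃ F N θ.toStage13Params p) (k + 1) s = 0) :
    (∃ σ : Sect3Supplier θ p, SupplierObligations θ p σ ∧ SupplierBorel θ p σ) ↔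
      ∃ (u : SeqOfRecord F θ.ν θ.τ9.M (gOfRecord₁₃ F N θ.toStage13Params p) p.K 1 → Sect2.TermValues (F.P p.K) (MatA N) (FluctV N) θ.τ9.M)
        (E₁ : SeqOfRecord F θ.ν θ.τ9.M (gOfRecord₁₃ F N θ.toStage13Params p) p.K 1 → ℝ),
        ((∀ s : SeqOfRecord F θ.ν θ.τ9.M (gOfRecord₁₃ F N θ.toStage13Params p) p.K 1, IsFluctLocal 1 (u s)) ∧
          (0 < p.K →
            Sect2.UniversalE u ∧
            (∀ s : SeqOfRecord F θ.ν θ.τ9.M (gOfRecord₁₃ F N θ.toStage13Params p) p.K 1, NewEClausesAt θ p 0 (u s) s) ∧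
            (∀ s : SeqOfRecord F θ.ν θ.τ9.M (gOfRecord₁₃ F N θ.toStage13Params p) p.K 1, s.Ω 1 ≠ ∅ →
              slotsTOfRecord F N θ.ν θ.τ9 (EOfRecord₁₃ F N θ.toStage13Params) (wOfRecord₉ F N θ.toStage9Params) θ.ppSel p (gOfRecord₁₃ F N θ.toStage13Params p) 1 s ≠ 0 →
                FirstStepClausesAt θ p s (u s) (E₁ s)))) ∧
        ∀ (s₀ : SeqOfRecord F θ.ν θ.τ9.M (gOfRecord₁₃ F N θ.toStage13Params p) p.K 1) (S' : ℕ → Set (Site (F.P p.K) 0)) (j : ℕ) (X : (Sect2.domSys (F.P p.K) θ.τ9.M j).Dom),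
          Measurable (fun q : GaugeField (F.P p.K) 0 (SU N) × MSFluct (F.P p.K) (FluctV N) =>
          (u s₀).B j X (Sect2.ofBackgroundC (settingOfRecord₁₃ F N θ.toStage13Params p).ι q.1) (S', q.2)) := by
  constructor
  · rintro ⟨σ, hσ, hσB⟩
    exact ⟨_, _, (supplierObligations_firstStepSupplier_iff_data _ _ hE₀ habs).mp (supplierObligations_firstStepSupplier_of_supplierObligations hE₀ habs hσ),
      fun s₀ S' j X => hσB 0 s₀ S' j X⟩
  · rintro ⟨u, E₁, h, hu⟩
    exact ⟨_, (supplierObligations_firstStepSupplier_iff_data u E₁ hE₀ habs).mpr h, (supplierBorel_firstStepSupplier_iff θ p u E₁).mpr hu⟩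

end Borel

/-! ## §2  N11's token, THEOREM 1 (all levels) and the p. 245 laws in such a run, at a Gaussian-class `θ`, from first-step data + u-Borel-ness + K0's rows (p607459 §3) -/

section Generic

variable {θ : Stage13HParams F N} {p : B12.RunParams}
variable (u : SeqOfRecord F θ.ν θ.τ9.M (gOfRecord₁₃ F N θ.toStage13Params p) p.K 1 → Sect2.TermValues (F.P p.K) (MatA N) (FluctV N) θ.τ9.M)
  (E₁ : SeqOfRecord F θ.ν θ.τ9.M (gOfRecord₁₃ F N θ.toStage13Params p) p.K 1 → ℝ)

/-- **★★ N11's ONE-TOKEN RESIDUAL `SupplyChainAt θ p` IN A RUN WITH NO 𝐓-PRESENT EXPANSION CHILD ABOVE THE FIRST LEVEL, AT ANY `θ` OF THE GAUSSIAN-CERTIFICATE CLASS, FROM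
FIRST-STEP DATA + u-BOREL-NESS + K0's ROWS** — this seat's `supplyChainAt_of_gaussCert_of_supplierBorel_of_solvable` (p607459 §3) at `σ := firstStepSupplier θ p u E₁`, whose
`SupplierObligations` are dag-n08-w2's `supplierObligations_firstStepSupplier` (`0 ≤ E₀`, `1`-locality of `u`, the first link, absence above the first level) and whose
`SupplierBorel` is §1.  Displayed per run: the certificate (`hζ`, `hq`), the key, admissibility, `0 < M₁ ≤ M`, `2 ≤ cR`, the window, `PartCompat₁₃` up to `K`, the five numeric
rows, K0's per-cube [15]-solvability, the cube cover.  NO term row, NO 𝐄 ∕ 𝐑 ∕ 𝐁 bound, NO reading-line primitive.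
[cite: Balaban1988Convergent, Thm 1 p.262, Theorem p.245, §3 p.279, (3.24)–(3.25) p.270, (2.27)–(2.28) p.259, p.257; Balaban1987RG1, Thm 1 p.258; Balaban1985Variational, Thm 1 (7)–(8) pp.278–279] -/
theorem supplyChainAt_of_firstStepSupplier_of_gaussCert_of_borelB_of_solvable
    (hζ : ∀ (p' : B12.RunParams) (n : ℕ) (Ω Λ : ℕ → Set (Site (F.P p'.K) 0)), (θ.Zh p' n Ω Λ).ζ0 = (ZhPinOfRecord₁₃ θ.toStage13Params p' Ω Λ).ζ0)
    (hq : ∀ (p' : B12.RunParams) (n : ℕ) (Ω Λ : ℕ → Set (Site (F.P p'.K) 0)) (j : ℕ) (Λ' : Set (Site (F.P p'.K) 0)) (ω : MultiCfg (F.P p'.K) (SU N) (FluctV N)),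
      (θ.Zh p' n Ω Λ).quad j Λ' ω = ∑ b ∈ (Set.toFinite (bondsIn j (Λ'ᶜ ∩ Ω (j + 1)))).toFinset, ‖(ω j).2 b‖ ^ 2)
    (h : θ.Provisos₁₃SepCoPH F N) (hθ : θ.Admissible F N) (hM₁ : 0 < θ.ν.M₁) (hle : θ.ν.M₁ ≤ θ.τ9.M) (hcR : 2 ≤ θ.s2.cR) (hE₀ : 0 ≤ θ.s2.lf.E₀)
    (hw : Step.InInterval θ.γ p.K (gOfRecord₁₃ F N θ.toStage13Params p)) (hPC : PartCompat₁₃ F N θ.toStage13Params p p.K)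
    (h3 : ∀ j, 1 ≤ j → j ≤ p.K →
      3 * side (F.P p.K).L θ.ν.M₁ j ≤ cubeSide (F.P p.K).L θ.ν.M₂ (RkOfRecord (F.P p.K).L θ.ν.r (gOfRecord₁₃ F N θ.toStage13Params p j)) j)
    (hR : ∀ j, 1 ≤ j → j ≤ p.K → (F.P p.K).L ^ j + (((F.P p.K).d + 4) * (F.P p.K).L + 2) * (∑ l ∈ Finset.range j, (F.P p.K).L ^ l) + 2 ≤
      cubeSide (F.P p.K).L θ.ν.M₂ (RkOfRecord (F.P p.K).L θ.ν.r (gOfRecord₁₃ F N θ.toStage13Params p j)) j)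
    (hε : ∀ j, 1 ≤ j → j ≤ p.K → 0 < epsOfRecord θ.ν (gOfRecord₁₃ F N θ.toStage13Params p) j)
    (hε3 : ∀ j, 1 ≤ j → j ≤ p.K → (143 * (((((F.P p.K).d + 4 : ℕ) : ℝ)) ^ 2 / 4) ^ 2) * epsOfRecord θ.ν (gOfRecord₁₃ F N θ.toStage13Params p) j ≤ 1 / 3)
    (hε2 : ∀ j, 1 ≤ j → j ≤ p.K →
      2 * epsOfRecord θ.ν (gOfRecord₁₃ F N θ.toStage13Params p) j ≤ 2 * ExpMeanLog.deltaSU (Fin N) / ((((F.P p.K).d + 4) * (F.P p.K).L : ℕ) : ℝ) ^ 2)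
    (hsolv : ∀ j, 1 ≤ j → j ≤ p.K → ∀ (s : SeqOfRecord F θ.ν θ.τ9.M (gOfRecord₁₃ F N θ.toStage13Params p) p.K j) (V : GaugeField (F.P p.K) j (SU N)),
      chiSeqOfRecord F N θ.ν θ.τ9.M (gOfRecord₁₃ F N θ.toStage13Params p) p.K j s V ≠ 0 →
      ∀ a ∈ cubesIn (fun a : ↥(cubeIndices (F.P p.K) (cubeSide (F.P p.K).L θ.ν.M₂ (RkOfRecord (F.P p.K).L θ.ν.r (gOfRecord₁₃ F N θ.toStage13Params p j)) j)) =>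
          cubeEnl (F.P p.K) (cubeSide (F.P p.K).L θ.ν.M₂ (RkOfRecord (F.P p.K).L θ.ν.r (gOfRecord₁₃ F N θ.toStage13Params p j)) j) a 0) (s.Ω j),
        ∃ U₀, IsMinimizer (avOfRecord F N p.K) {U | PlaqSmall (θ.ν.εreg * (F.P p.K).eta j ^ 2) U}
          (Bj θ.ν.M₁ (cubeEnl (F.P p.K) (cubeSide (F.P p.K).L θ.ν.M₂ (RkOfRecord (F.P p.K).L θ.ν.r (gOfRecord₁₃ F N θ.toStage13Params p j)) j) a 4) j)
          (avgFamily (avOfRecord F N p.K) (qsstarGIter0 j V)) U₀)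
    (hcov : ∀ j, 1 ≤ j → j ≤ p.K → ∀ s : SeqOfRecord F θ.ν θ.τ9.M (gOfRecord₁₃ F N θ.toStage13Params p) p.K j,
      s.Ω j ⊆ ⋃ a ∈ cubesIn (fun a : ↥(cubeIndices (F.P p.K) (cubeSide (F.P p.K).L θ.ν.M₂ (RkOfRecord (F.P p.K).L θ.ν.r (gOfRecord₁₃ F N θ.toStage13Params p j)) j)) =>
          cubeEnl (F.P p.K) (cubeSide (F.P p.K).L θ.ν.M₂ (RkOfRecord (F.P p.K).L θ.ν.r (gOfRecord₁₃ F N θ.toStage13Params p j)) j) a 0) (s.Ω j),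
        cubeEnl (F.P p.K) (cubeSide (F.P p.K).L θ.ν.M₂ (RkOfRecord (F.P p.K).L θ.ν.r (gOfRecord₁₃ F N θ.toStage13Params p j)) j) a 0)
    (habs : ∀ k, 1 ≤ k → k < p.K → ∀ s : SeqOfRecord F θ.ν θ.τ9.M (gOfRecord₁₃ F N θ.toStage13Params p) p.K (k + 1), s.Ω (k + 1) ≠ ∅ →
      slotsTOfRecord F N θ.ν θ.τ9 (EOfRecord₁₃ F N θ.toStage13Params) (wOfRecord₉ F N θ.toStage9Params) θ.ppSel p (gOfRecord₁₃ F N θ.toStage13Params p) (k + 1) s = 0)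
    (hloc : ∀ s : SeqOfRecord F θ.ν θ.τ9.M (gOfRecord₁₃ F N θ.toStage13Params p) p.K 1, IsFluctLocal 1 (u s))
    (hlink : 0 < p.K → FirstLinkObligations θ p (firstStepSupplier θ p u E₁))
    (hu : ∀ (s₀ : SeqOfRecord F θ.ν θ.τ9.M (gOfRecord₁₃ F N θ.toStage13Params p) p.K 1) (S' : ℕ → Set (Site (F.P p.K) 0)) (j : ℕ) (X : (Sect2.domSys (F.P p.K) θ.τ9.M j).Dom),
        Measurable (fun q : GaugeField (F.P p.K) 0 (SU N) × MSFluct (F.P p.K) (FluctV N) =>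
          (u s₀).B j X (Sect2.ofBackgroundC (settingOfRecord₁₃ F N θ.toStage13Params p).ι q.1) (S', q.2))) : SupplyChainAt θ p :=
  supplyChainAt_of_gaussCert_of_supplierBorel_of_solvable θ p hζ hq h hθ hM₁ hle hcR hw hPC h3 hR hε hε3 hε2 hsolv hcov (firstStepSupplier θ p u E₁)
    (supplierObligations_firstStepSupplier u E₁ hE₀ habs hloc hlink) ((supplierBorel_firstStepSupplier_iff θ p u E₁).mpr hu)

/-- **THEOREM 1 OF [III] — `∀ k ≤ K, SLaw₁₃CoPH θ p k` — IN SUCH A RUN AT A GAUSSIAN-CLASS `θ` FROM FIRST-STEP DATA + u-BOREL-NESS + K0's ROWS** on the live-selector line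
(selector clause, admissibility, `0 ≤ κ, E₀, B₀`): p607459 §3's ★★★★ along the first-step supplier's chain. [cite: Balaban1988Convergent, Thm 1 p.262, Theorem p.245, §3 p.279, (3.24)–(3.25) p.270; Balaban1987RG1, Thm 1 p.258; Balaban1989LargeFieldI, (0.2)–(0.4) p.176, p.177 (i)–(ii)] -/
theorem sLaw₁₃CoPH_all_of_firstStepSupplier_of_gaussCert_of_borelB_of_solvable
    (hζ : ∀ (p' : B12.RunParams) (n : ℕ) (Ω Λ : ℕ → Set (Site (F.P p'.K) 0)), (θ.Zh p' n Ω Λ).ζ0 = (ZhPinOfRecord₁₃ θ.toStage13Params p' Ω Λ).ζ0)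
    (hq : ∀ (p' : B12.RunParams) (n : ℕ) (Ω Λ : ℕ → Set (Site (F.P p'.K) 0)) (j : ℕ) (Λ' : Set (Site (F.P p'.K) 0)) (ω : MultiCfg (F.P p'.K) (SU N) (FluctV N)),
      (θ.Zh p' n Ω Λ).quad j Λ' ω = ∑ b ∈ (Set.toFinite (bondsIn j (Λ'ᶜ ∩ Ω (j + 1)))).toFinset, ‖(ω j).2 b‖ ^ 2)
    (h : θ.Provisos₁₃SepCoPH F N)
    (hsel : θ.ppSel = ppSelLiveOfRecord F N θ.ν θ.τ9 (EOfRecord₁₃ F N θ.toStage13Params) (wOfRecord₉ F N θ.toStage9Params))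
    (hθ : θ.Admissible F N) (hκ : 0 ≤ θ.s2.lf.κ) (hE₀ : 0 ≤ θ.s2.lf.E₀) (hB₀ : 0 ≤ θ.s2.lf.B₀)
    (hM₁ : 0 < θ.ν.M₁) (hle : θ.ν.M₁ ≤ θ.τ9.M) (hcR : 2 ≤ θ.s2.cR)
    (hw : Step.InInterval θ.γ p.K (gOfRecord₁₃ F N θ.toStage13Params p)) (hPC : PartCompat₁₃ F N θ.toStage13Params p p.K)
    (h3 : ∀ j, 1 ≤ j → j ≤ p.K →
      3 * side (F.P p.K).L θ.ν.M₁ j ≤ cubeSide (F.P p.K).L θ.ν.M₂ (RkOfRecord (F.P p.K).L θ.ν.r (gOfRecord₁₃ F N θ.toStage13Params p j)) j)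
    (hR : ∀ j, 1 ≤ j → j ≤ p.K → (F.P p.K).L ^ j + (((F.P p.K).d + 4) * (F.P p.K).L + 2) * (∑ l ∈ Finset.range j, (F.P p.K).L ^ l) + 2 ≤
      cubeSide (F.P p.K).L θ.ν.M₂ (RkOfRecord (F.P p.K).L θ.ν.r (gOfRecord₁₃ F N θ.toStage13Params p j)) j)
    (hε : ∀ j, 1 ≤ j → j ≤ p.K → 0 < epsOfRecord θ.ν (gOfRecord₁₃ F N θ.toStage13Params p) j)
    (hε3 : ∀ j, 1 ≤ j → j ≤ p.K → (143 * (((((F.P p.K).d + 4 : ℕ) : ℝ)) ^ 2 / 4) ^ 2) * epsOfRecord θ.ν (gOfRecord₁₃ F N θ.toStage13Params p) j ≤ 1 / 3)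
    (hε2 : ∀ j, 1 ≤ j → j ≤ p.K →
      2 * epsOfRecord θ.ν (gOfRecord₁₃ F N θ.toStage13Params p) j ≤ 2 * ExpMeanLog.deltaSU (Fin N) / ((((F.P p.K).d + 4) * (F.P p.K).L : ℕ) : ℝ) ^ 2)
    (hsolv : ∀ j, 1 ≤ j → j ≤ p.K → ∀ (s : SeqOfRecord F θ.ν θ.τ9.M (gOfRecord₁₃ F N θ.toStage13Params p) p.K j) (V : GaugeField (F.P p.K) j (SU N)),
      chiSeqOfRecord F N θ.ν θ.τ9.M (gOfRecord₁₃ F N θ.toStage13Params p) p.K j s V ≠ 0 →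
      ∀ a ∈ cubesIn (fun a : ↥(cubeIndices (F.P p.K) (cubeSide (F.P p.K).L θ.ν.M₂ (RkOfRecord (F.P p.K).L θ.ν.r (gOfRecord₁₃ F N θ.toStage13Params p j)) j)) =>
          cubeEnl (F.P p.K) (cubeSide (F.P p.K).L θ.ν.M₂ (RkOfRecord (F.P p.K).L θ.ν.r (gOfRecord₁₃ F N θ.toStage13Params p j)) j) a 0) (s.Ω j),
        ∃ U₀, IsMinimizer (avOfRecord F N p.K) {U | PlaqSmall (θ.ν.εreg * (F.P p.K).eta j ^ 2) U}
          (Bj θ.ν.M₁ (cubeEnl (F.P p.K) (cubeSide (F.P p.K).L θ.ν.M₂ (RkOfRecord (F.P p.K).L θ.ν.r (gOfRecord₁₃ F N θ.toStage13Params p j)) j) a 4) j)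
          (avgFamily (avOfRecord F N p.K) (qsstarGIter0 j V)) U₀)
    (hcov : ∀ j, 1 ≤ j → j ≤ p.K → ∀ s : SeqOfRecord F θ.ν θ.τ9.M (gOfRecord₁₃ F N θ.toStage13Params p) p.K j,
      s.Ω j ⊆ ⋃ a ∈ cubesIn (fun a : ↥(cubeIndices (F.P p.K) (cubeSide (F.P p.K).L θ.ν.M₂ (RkOfRecord (F.P p.K).L θ.ν.r (gOfRecord₁₃ F N θ.toStage13Params p j)) j)) =>
          cubeEnl (F.P p.K) (cubeSide (F.P p.K).L θ.ν.M₂ (RkOfRecord (F.P p.K).L θ.ν.r (gOfRecord₁₃ F N θ.toStage13Params p j)) j) a 0) (s.Ω j),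
        cubeEnl (F.P p.K) (cubeSide (F.P p.K).L θ.ν.M₂ (RkOfRecord (F.P p.K).L θ.ν.r (gOfRecord₁₃ F N θ.toStage13Params p j)) j) a 0)
    (habs : ∀ k, 1 ≤ k → k < p.K → ∀ s : SeqOfRecord F θ.ν θ.τ9.M (gOfRecord₁₃ F N θ.toStage13Params p) p.K (k + 1), s.Ω (k + 1) ≠ ∅ →
      slotsTOfRecord F N θ.ν θ.τ9 (EOfRecord₁₃ F N θ.toStage13Params) (wOfRecord₉ F N θ.toStage9Params) θ.ppSel p (gOfRecord₁₃ F N θ.toStage13Params p) (k + 1) s = 0)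
    (hloc : ∀ s : SeqOfRecord F θ.ν θ.τ9.M (gOfRecord₁₃ F N θ.toStage13Params p) p.K 1, IsFluctLocal 1 (u s))
    (hlink : 0 < p.K → FirstLinkObligations θ p (firstStepSupplier θ p u E₁))
    (hu : ∀ (s₀ : SeqOfRecord F θ.ν θ.τ9.M (gOfRecord₁₃ F N θ.toStage13Params p) p.K 1) (S' : ℕ → Set (Site (F.P p.K) 0)) (j : ℕ) (X : (Sect2.domSys (F.P p.K) θ.τ9.M j).Dom),
        Measurable (fun q : GaugeField (F.P p.K) 0 (SU N) × MSFluct (F.P p.K) (FluctV N) =>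
          (u s₀).B j X (Sect2.ofBackgroundC (settingOfRecord₁₃ F N θ.toStage13Params p).ι q.1) (S', q.2))) : ∀ k, k ≤ p.K → SLaw₁₃CoPH F N θ p k :=
  sLaw₁₃CoPH_all_of_obligations_of_gaussCert_of_supplierBorel_of_solvable θ p hζ hq h hsel hθ hκ hE₀ hB₀ hM₁ hle hcR hw hPC h3 hR hε hε3 hε2 hsolv hcov
    (firstStepSupplier θ p u E₁) (supplierObligations_firstStepSupplier u E₁ hE₀ habs hloc hlink) ((supplierBorel_firstStepSupplier_iff θ p u E₁).mpr hu)

/-- **THE THEOREM OF p. 245 IN LAW FORM — `∀ k < K, SLaw₁₃CoPH θ p k → TLaw₁₃CoPH θ p k` (the `h11`-consequent) — IN SUCH A RUN AT A GAUSSIAN-CLASS `θ` FROM THE SAME DATA**.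
[cite: Balaban1988Convergent, Theorem p.245, Thm 1 p.262, remark p.262, §3 p.279, (3.25) p.270; Balaban1987RG1, Thm 1 p.258] -/
theorem thmP245Laws_of_firstStepSupplier_of_gaussCert_of_borelB_of_solvable
    (hζ : ∀ (p' : B12.RunParams) (n : ℕ) (Ω Λ : ℕ → Set (Site (F.P p'.K) 0)), (θ.Zh p' n Ω Λ).ζ0 = (ZhPinOfRecord₁₃ θ.toStage13Params p' Ω Λ).ζ0)
    (hq : ∀ (p' : B12.RunParams) (n : ℕ) (Ω Λ : ℕ → Set (Site (F.P p'.K) 0)) (j : ℕ) (Λ' : Set (Site (F.P p'.K) 0)) (ω : MultiCfg (F.P p'.K) (SU N) (FluctV N)),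
      (θ.Zh p' n Ω Λ).quad j Λ' ω = ∑ b ∈ (Set.toFinite (bondsIn j (Λ'ᶜ ∩ Ω (j + 1)))).toFinset, ‖(ω j).2 b‖ ^ 2)
    (h : θ.Provisos₁₃SepCoPH F N)
    (hsel : θ.ppSel = ppSelLiveOfRecord F N θ.ν θ.τ9 (EOfRecord₁₃ F N θ.toStage13Params) (wOfRecord₉ F N θ.toStage9Params))
    (hθ : θ.Admissible F N) (hκ : 0 ≤ θ.s2.lf.κ) (hE₀ : 0 ≤ θ.s2.lf.E₀) (hB₀ : 0 ≤ θ.s2.lf.B₀)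
    (hM₁ : 0 < θ.ν.M₁) (hle : θ.ν.M₁ ≤ θ.τ9.M) (hcR : 2 ≤ θ.s2.cR)
    (hw : Step.InInterval θ.γ p.K (gOfRecord₁₃ F N θ.toStage13Params p)) (hPC : PartCompat₁₃ F N θ.toStage13Params p p.K)
    (h3 : ∀ j, 1 ≤ j → j ≤ p.K →
      3 * side (F.P p.K).L θ.ν.M₁ j ≤ cubeSide (F.P p.K).L θ.ν.M₂ (RkOfRecord (F.P p.K).L θ.ν.r (gOfRecord₁₃ F N θ.toStage13Params p j)) j)
    (hR : ∀ j, 1 ≤ j → j ≤ p.K → (F.P p.K).L ^ j + (((F.P p.K).d + 4) * (F.P p.K).L + 2) * (∑ l ∈ Finset.range j, (F.P p.K).L ^ l) + 2 ≤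
      cubeSide (F.P p.K).L θ.ν.M₂ (RkOfRecord (F.P p.K).L θ.ν.r (gOfRecord₁₃ F N θ.toStage13Params p j)) j)
    (hε : ∀ j, 1 ≤ j → j ≤ p.K → 0 < epsOfRecord θ.ν (gOfRecord₁₃ F N θ.toStage13Params p) j)
    (hε3 : ∀ j, 1 ≤ j → j ≤ p.K → (143 * (((((F.P p.K).d + 4 : ℕ) : ℝ)) ^ 2 / 4) ^ 2) * epsOfRecord θ.ν (gOfRecord₁₃ F N θ.toStage13Params p) j ≤ 1 / 3)
    (hε2 : ∀ j, 1 ≤ j → j ≤ p.K →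
      2 * epsOfRecord θ.ν (gOfRecord₁₃ F N θ.toStage13Params p) j ≤ 2 * ExpMeanLog.deltaSU (Fin N) / ((((F.P p.K).d + 4) * (F.P p.K).L : ℕ) : ℝ) ^ 2)
    (hsolv : ∀ j, 1 ≤ j → j ≤ p.K → ∀ (s : SeqOfRecord F θ.ν θ.τ9.M (gOfRecord₁₃ F N θ.toStage13Params p) p.K j) (V : GaugeField (F.P p.K) j (SU N)),
      chiSeqOfRecord F N θ.ν θ.τ9.M (gOfRecord₁₃ F N θ.toStage13Params p) p.K j s V ≠ 0 →
      ∀ a ∈ cubesIn (fun a : ↥(cubeIndices (F.P p.K) (cubeSide (F.P p.K).L θ.ν.M₂ (RkOfRecord (F.P p.K).L θ.ν.r (gOfRecord₁₃ F N θ.toStage13Params p j)) j)) =>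
          cubeEnl (F.P p.K) (cubeSide (F.P p.K).L θ.ν.M₂ (RkOfRecord (F.P p.K).L θ.ν.r (gOfRecord₁₃ F N θ.toStage13Params p j)) j) a 0) (s.Ω j),
        ∃ U₀, IsMinimizer (avOfRecord F N p.K) {U | PlaqSmall (θ.ν.εreg * (F.P p.K).eta j ^ 2) U}
          (Bj θ.ν.M₁ (cubeEnl (F.P p.K) (cubeSide (F.P p.K).L θ.ν.M₂ (RkOfRecord (F.P p.K).L θ.ν.r (gOfRecord₁₃ F N θ.toStage13Params p j)) j) a 4) j)
          (avgFamily (avOfRecord F N p.K) (qsstarGIter0 j V)) U₀)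
    (hcov : ∀ j, 1 ≤ j → j ≤ p.K → ∀ s : SeqOfRecord F θ.ν θ.τ9.M (gOfRecord₁₃ F N θ.toStage13Params p) p.K j,
      s.Ω j ⊆ ⋃ a ∈ cubesIn (fun a : ↥(cubeIndices (F.P p.K) (cubeSide (F.P p.K).L θ.ν.M₂ (RkOfRecord (F.P p.K).L θ.ν.r (gOfRecord₁₃ F N θ.toStage13Params p j)) j)) =>
          cubeEnl (F.P p.K) (cubeSide (F.P p.K).L θ.ν.M₂ (RkOfRecord (F.P p.K).L θ.ν.r (gOfRecord₁₃ F N θ.toStage13Params p j)) j) a 0) (s.Ω j),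
        cubeEnl (F.P p.K) (cubeSide (F.P p.K).L θ.ν.M₂ (RkOfRecord (F.P p.K).L θ.ν.r (gOfRecord₁₃ F N θ.toStage13Params p j)) j) a 0)
    (habs : ∀ k, 1 ≤ k → k < p.K → ∀ s : SeqOfRecord F θ.ν θ.τ9.M (gOfRecord₁₃ F N θ.toStage13Params p) p.K (k + 1), s.Ω (k + 1) ≠ ∅ →
      slotsTOfRecord F N θ.ν θ.τ9 (EOfRecord₁₃ F N θ.toStage13Params) (wOfRecord₉ F N θ.toStage9Params) θ.ppSel p (gOfRecord₁₃ F N θ.toStage13Params p) (k + 1) s = 0)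
    (hloc : ∀ s : SeqOfRecord F θ.ν θ.τ9.M (gOfRecord₁₃ F N θ.toStage13Params p) p.K 1, IsFluctLocal 1 (u s))
    (hlink : 0 < p.K → FirstLinkObligations θ p (firstStepSupplier θ p u E₁))
    (hu : ∀ (s₀ : SeqOfRecord F θ.ν θ.τ9.M (gOfRecord₁₃ F N θ.toStage13Params p) p.K 1) (S' : ℕ → Set (Site (F.P p.K) 0)) (j : ℕ) (X : (Sect2.domSys (F.P p.K) θ.τ9.M j).Dom),
        Measurable (fun q : GaugeField (F.P p.K) 0 (SU N) × MSFluct (F.P p.K) (FluctV N) =>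
          (u s₀).B j X (Sect2.ofBackgroundC (settingOfRecord₁₃ F N θ.toStage13Params p).ι q.1) (S', q.2))) : ∀ k, k < p.K → SLaw₁₃CoPH F N θ p k → TLaw₁₃CoPH F N θ p k :=
  thmP245Laws_of_gaussCert_of_supplierBorel_of_solvable θ p hζ hq h hsel hθ hκ hE₀ hB₀ hM₁ hle hcR hw hPC h3 hR hε hε3 hε2 hsolv hcov
    (firstStepSupplier θ p u E₁) (supplierObligations_firstStepSupplier u E₁ hE₀ habs hloc hlink) ((supplierBorel_firstStepSupplier_iff θ p u E₁).mpr hu)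

end Generic

/-! ## §3  The same with the numeric rows and the cube cover folded to scalars (p609410 §6), and at the NAMED certificate `gaussPinH θ` -/

section Scalars

variable {θ : Stage13HParams F N} {p : B12.RunParams}
variable (u : SeqOfRecord F θ.ν θ.τ9.M (gOfRecord₁₃ F N θ.toStage13Params p) p.K 1 → Sect2.TermValues (F.P p.K) (MatA N) (FluctV N) θ.τ9.M)
  (E₁ : SeqOfRecord F θ.ν θ.τ9.M (gOfRecord₁₃ F N θ.toStage13Params p) p.K 1 → ℝ)

/-- **N11's TOKEN IN SUCH A RUN AT A GAUSSIAN-CLASS `θ` FROM FIRST-STEP DATA + u-BOREL-NESS, THE FIVE NUMERIC ROWS AND THE COVER AS SCALARS** (`L·M₂ ∣ M`, `3·M₁ ≤ L·M₂`,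
`8L + 3 ≤ L·M₂`, `0 < A₀`, `θ.γ < 1`, `θ.γ ≤ e^{−p₀}`, the two edge inequalities — dag-n11-w3 ∕ dag-n11-w4's rows via p609410 §6), per run `PartCompat₁₃` + K0's solvability.
[cite: Balaban1988Convergent, Thm 1 p.262, Theorem p.245, §3 p.279, (2.4)–(2.5) p.255, (2.13) pp.256–257, (2.17) p.257, (3.24)–(3.25) p.270; Balaban1987RG1, Thm 1 p.258; Balaban1985Variational, Thm 1 (7)–(8) pp.278–279] -/
theorem supplyChainAt_of_firstStepSupplier_of_gaussCert_of_borelB_of_nesting_of_scalars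
    (hζ : ∀ (p' : B12.RunParams) (n : ℕ) (Ω Λ : ℕ → Set (Site (F.P p'.K) 0)), (θ.Zh p' n Ω Λ).ζ0 = (ZhPinOfRecord₁₃ θ.toStage13Params p' Ω Λ).ζ0)
    (hq : ∀ (p' : B12.RunParams) (n : ℕ) (Ω Λ : ℕ → Set (Site (F.P p'.K) 0)) (j : ℕ) (Λ' : Set (Site (F.P p'.K) 0)) (ω : MultiCfg (F.P p'.K) (SU N) (FluctV N)),
      (θ.Zh p' n Ω Λ).quad j Λ' ω = ∑ b ∈ (Set.toFinite (bondsIn j (Λ'ᶜ ∩ Ω (j + 1)))).toFinset, ‖(ω j).2 b‖ ^ 2)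
    (h : θ.Provisos₁₃SepCoPH F N) (hθ : θ.Admissible F N) (hM₁ : 0 < θ.ν.M₁) (hle : θ.ν.M₁ ≤ θ.τ9.M) (hcR : 2 ≤ θ.s2.cR) (hE₀ : 0 ≤ θ.s2.lf.E₀)
    (hdiv : F.L * θ.ν.M₂ ∣ θ.τ9.M) (hM3 : 3 * θ.ν.M₁ ≤ F.L * θ.ν.M₂) (hMd : 8 * F.L + 3 ≤ F.L * θ.ν.M₂)
    (hA : 0 < θ.ν.A₀) (hγ1 : θ.γ < 1) (hγp : θ.γ ≤ Real.exp (-(θ.ν.p₀ : ℝ)))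
    (hg3 : (143 * ((((8 : ℕ) : ℝ)) ^ 2 / 4) ^ 2) * (θ.γ * (θ.ν.A₀ * (Real.log (θ.γ ^ 2)⁻¹) ^ θ.ν.p₀)) ≤ 1 / 3)
    (hg2 : 2 * (θ.γ * (θ.ν.A₀ * (Real.log (θ.γ ^ 2)⁻¹) ^ θ.ν.p₀)) ≤ 2 * ExpMeanLog.deltaSU (Fin N) / (((8 * F.L : ℕ) : ℝ)) ^ 2)
    (hw : Step.InInterval θ.γ p.K (gOfRecord₁₃ F N θ.toStage13Params p)) (hPC : PartCompat₁₃ F N θ.toStage13Params p p.K)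
    (hsolv : ∀ j, 1 ≤ j → j ≤ p.K → ∀ (s : SeqOfRecord F θ.ν θ.τ9.M (gOfRecord₁₃ F N θ.toStage13Params p) p.K j) (V : GaugeField (F.P p.K) j (SU N)),
      chiSeqOfRecord F N θ.ν θ.τ9.M (gOfRecord₁₃ F N θ.toStage13Params p) p.K j s V ≠ 0 →
      ∀ a ∈ cubesIn (fun a : ↥(cubeIndices (F.P p.K) (cubeSide (F.P p.K).L θ.ν.M₂ (RkOfRecord (F.P p.K).L θ.ν.r (gOfRecord₁₃ F N θ.toStage13Params p j)) j)) =>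
          cubeEnl (F.P p.K) (cubeSide (F.P p.K).L θ.ν.M₂ (RkOfRecord (F.P p.K).L θ.ν.r (gOfRecord₁₃ F N θ.toStage13Params p j)) j) a 0) (s.Ω j),
        ∃ U₀, IsMinimizer (avOfRecord F N p.K) {U | PlaqSmall (θ.ν.εreg * (F.P p.K).eta j ^ 2) U}
          (Bj θ.ν.M₁ (cubeEnl (F.P p.K) (cubeSide (F.P p.K).L θ.ν.M₂ (RkOfRecord (F.P p.K).L θ.ν.r (gOfRecord₁₃ F N θ.toStage13Params p j)) j) a 4) j)
          (avgFamily (avOfRecord F N p.K) (qsstarGIter0 j V)) U₀)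
    (habs : ∀ k, 1 ≤ k → k < p.K → ∀ s : SeqOfRecord F θ.ν θ.τ9.M (gOfRecord₁₃ F N θ.toStage13Params p) p.K (k + 1), s.Ω (k + 1) ≠ ∅ →
      slotsTOfRecord F N θ.ν θ.τ9 (EOfRecord₁₃ F N θ.toStage13Params) (wOfRecord₉ F N θ.toStage9Params) θ.ppSel p (gOfRecord₁₃ F N θ.toStage13Params p) (k + 1) s = 0)
    (hloc : ∀ s : SeqOfRecord F θ.ν θ.τ9.M (gOfRecord₁₃ F N θ.toStage13Params p) p.K 1, IsFluctLocal 1 (u s))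
    (hlink : 0 < p.K → FirstLinkObligations θ p (firstStepSupplier θ p u E₁))
    (hu : ∀ (s₀ : SeqOfRecord F θ.ν θ.τ9.M (gOfRecord₁₃ F N θ.toStage13Params p) p.K 1) (S' : ℕ → Set (Site (F.P p.K) 0)) (j : ℕ) (X : (Sect2.domSys (F.P p.K) θ.τ9.M j).Dom),
        Measurable (fun q : GaugeField (F.P p.K) 0 (SU N) × MSFluct (F.P p.K) (FluctV N) =>
          (u s₀).B j X (Sect2.ofBackgroundC (settingOfRecord₁₃ F N θ.toStage13Params p).ι q.1) (S', q.2))) : SupplyChainAt θ p :=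
  supplyChainAt_of_gaussCert_of_supplierBorel_of_nesting_of_scalars θ p hζ hq h hθ hM₁ hle hcR hdiv hM3 hMd hA hγ1 hγp hg3 hg2 hw hPC hsolv (firstStepSupplier θ p u E₁)
    (supplierObligations_firstStepSupplier u E₁ hE₀ habs hloc hlink) ((supplierBorel_firstStepSupplier_iff θ p u E₁).mpr hu)

end Scalars

section Named

variable (θ : Stage13HParams F N) (p : B12.RunParams)
variable (u : SeqOfRecord F (gaussPinH θ).ν (gaussPinH θ).τ9.M (gOfRecord₁₃ F N (gaussPinH θ).toStage13Params p) p.K 1 → Sect2.TermValues (F.P p.K) (MatA N) (FluctV N) (gaussPinH θ).τ9.M)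
  (E₁ : SeqOfRecord F (gaussPinH θ).ν (gaussPinH θ).τ9.M (gOfRecord₁₃ F N (gaussPinH θ).toStage13Params p) p.K 1 → ℝ)

/-- **★★ `SupplyChainAt (gaussPinH θ) p` AT THE NAMED GAUSSIAN CERTIFICATE OF ANY `θ`, IN SUCH A RUN, FROM FIRST-STEP DATA AT THE CERTIFICATE + u-BOREL-NESS + THE SCALARS +
PER RUN `PartCompat₁₃` AND K0's SOLVABILITY** — NO class hypothesis (`gaussPinH_ζ0 ∕ gaussPinH_quad` are `rfl`, the key transfers by `provisos₁₃SepCoPH_gaussPinH`); the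
certificate shares `θ.toStage13Params` (`gaussPinH_toStage13Params`, `rfl`), so the first-step data, the histories and the numeric letters are `θ`'s.  p609410 §6's named face at
`σ := firstStepSupplier (gaussPinH θ) p u E₁`. [cite: Balaban1988Convergent, Thm 1 p.262, Theorem p.245, §3 p.279, (3.16) p.268, (3.24)–(3.25) p.270; Balaban1987RG1, Thm 1 p.258; Balaban1985Variational, Thm 1 (7)–(8) pp.278–279] -/
theorem supplyChainAt_gaussPinH_of_firstStepSupplier_of_borelB_of_nesting_of_scalars
    (h : θ.Provisos₁₃SepCoPH F N) (hθ : θ.Admissible F N) (hM₁ : 0 < θ.ν.M₁) (hle : θ.ν.M₁ ≤ θ.τ9.M) (hcR : 2 ≤ θ.s2.cR) (hE₀ : 0 ≤ θ.s2.lf.E₀)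
    (hdiv : F.L * θ.toStage13Params.ν.M₂ ∣ θ.toStage13Params.τ9.M) (hM3 : 3 * θ.toStage13Params.ν.M₁ ≤ F.L * θ.toStage13Params.ν.M₂) (hMd : 8 * F.L + 3 ≤ F.L * θ.toStage13Params.ν.M₂)
    (hA : 0 < θ.toStage13Params.ν.A₀) (hγ1 : θ.toStage13Params.γ < 1) (hγp : θ.toStage13Params.γ ≤ Real.exp (-(θ.toStage13Params.ν.p₀ : ℝ)))
    (hg3 : (143 * ((((8 : ℕ) : ℝ)) ^ 2 / 4) ^ 2) * (θ.toStage13Params.γ * (θ.toStage13Params.ν.A₀ * (Real.log (θ.toStage13Params.γ ^ 2)⁻¹) ^ θ.toStage13Params.ν.p₀)) ≤ 1 / 3)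
    (hg2 : 2 * (θ.toStage13Params.γ * (θ.toStage13Params.ν.A₀ * (Real.log (θ.toStage13Params.γ ^ 2)⁻¹) ^ θ.toStage13Params.ν.p₀)) ≤ 2 * ExpMeanLog.deltaSU (Fin N) / (((8 * F.L : ℕ) : ℝ)) ^ 2)
    (hw : Step.InInterval θ.toStage13Params.γ p.K (gOfRecord₁₃ F N θ.toStage13Params p)) (hPC : PartCompat₁₃ F N θ.toStage13Params p p.K)
    (hsolv : ∀ j, 1 ≤ j → j ≤ p.K → ∀ (s : SeqOfRecord F θ.toStage13Params.ν θ.toStage13Params.τ9.M (gOfRecord₁₃ F N θ.toStage13Params p) p.K j) (V : GaugeField (F.P p.K) j (SU N)),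
      chiSeqOfRecord F N θ.toStage13Params.ν θ.toStage13Params.τ9.M (gOfRecord₁₃ F N θ.toStage13Params p) p.K j s V ≠ 0 →
      ∀ a ∈ cubesIn (fun a : ↥(cubeIndices (F.P p.K) (cubeSide (F.P p.K).L θ.toStage13Params.ν.M₂ (RkOfRecord (F.P p.K).L θ.toStage13Params.ν.r (gOfRecord₁₃ F N θ.toStage13Params p j)) j)) =>
          cubeEnl (F.P p.K) (cubeSide (F.P p.K).L θ.toStage13Params.ν.M₂ (RkOfRecord (F.P p.K).L θ.toStage13Params.ν.r (gOfRecord₁₃ F N θ.toStage13Params p j)) j) a 0) (s.Ω j),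
        ∃ U₀, IsMinimizer (avOfRecord F N p.K) {U | PlaqSmall (θ.toStage13Params.ν.εreg * (F.P p.K).eta j ^ 2) U}
          (Bj θ.toStage13Params.ν.M₁ (cubeEnl (F.P p.K) (cubeSide (F.P p.K).L θ.toStage13Params.ν.M₂ (RkOfRecord (F.P p.K).L θ.toStage13Params.ν.r (gOfRecord₁₃ F N θ.toStage13Params p j)) j) a 4) j)
          (avgFamily (avOfRecord F N p.K) (qsstarGIter0 j V)) U₀)
    (habs : ∀ k, 1 ≤ k → k < p.K → ∀ s : SeqOfRecord F (gaussPinH θ).ν (gaussPinH θ).τ9.M (gOfRecord₁₃ F N (gaussPinH θ).toStage13Params p) p.K (k + 1), s.Ω (k + 1) ≠ ∅ →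
      slotsTOfRecord F N (gaussPinH θ).ν (gaussPinH θ).τ9 (EOfRecord₁₃ F N (gaussPinH θ).toStage13Params) (wOfRecord₉ F N (gaussPinH θ).toStage9Params) (gaussPinH θ).ppSel p (gOfRecord₁₃ F N (gaussPinH θ).toStage13Params p) (k + 1) s = 0)
    (hloc : ∀ s : SeqOfRecord F (gaussPinH θ).ν (gaussPinH θ).τ9.M (gOfRecord₁₃ F N (gaussPinH θ).toStage13Params p) p.K 1, IsFluctLocal 1 (u s))
    (hlink : 0 < p.K → FirstLinkObligations (gaussPinH θ) p (firstStepSupplier (gaussPinH θ) p u E₁))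
    (hu : ∀ (s₀ : SeqOfRecord F (gaussPinH θ).ν (gaussPinH θ).τ9.M (gOfRecord₁₃ F N (gaussPinH θ).toStage13Params p) p.K 1) (S' : ℕ → Set (Site (F.P p.K) 0)) (j : ℕ) (X : (Sect2.domSys (F.P p.K) (gaussPinH θ).τ9.M j).Dom),
        Measurable (fun q : GaugeField (F.P p.K) 0 (SU N) × MSFluct (F.P p.K) (FluctV N) =>
          (u s₀).B j X (Sect2.ofBackgroundC (settingOfRecord₁₃ F N (gaussPinH θ).toStage13Params p).ι q.1) (S', q.2))) : SupplyChainAt (gaussPinH θ) p :=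
  supplyChainAt_gaussPinH_of_supplierBorel_of_nesting_of_scalars θ p h hθ hM₁ hle hcR hdiv hM3 hMd hA hγ1 hγp hg3 hg2 hw hPC hsolv (firstStepSupplier (gaussPinH θ) p u E₁)
    (supplierObligations_firstStepSupplier u E₁ hE₀ habs hloc hlink) ((supplierBorel_firstStepSupplier_iff (gaussPinH θ) p u E₁).mpr hu)

end Named

end Summit.QuantumFields.YangMills.Theorems.BalabanUVNodesN11SupplyChainFirstStepSupplierBorelB

end
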